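import Literature.AlgebraicGeometry.Modules.GrothendieckComplexKernelRepr
import Literature.AlgebraicGeometry.Modules.CechComplexBaseChangeHmkQ
import Literature.AlgebraicGeometry.Modules.CechComplexTorsionOffBasicOpen
import Literature.AlgebraicGeometry.Modules.DetClassOfIso
import HarnessLib

/-!
# The slice reading of the Grothendieck complex: `H^b_mkQ(K• ⊗_{Γ(T)} Γ(y)) = H^b_mkQ(Č•(𝓥|_{P × y}, L|_{P × y}))` at a rational point `y ∈ T(K)`
# ([MumfordAV1970] §5 Cor. 2; [GortzWedhorn2023] Cor. 23.135)

Topic `Literature/AlgebraicGeometry/Modules`; namespace `Literature.AlgebraicGeometry.Modules`.  THEOREMS ONLY (no definition, no instance, no notation, no named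
fact, no `sorry`).  Cell `hodgecm-mathlib` (D-0151), «H1-DIM-ANY-CHAR cut», FILE 4b of B-p04 (g42)՚s HEAD assembly (deal 2026-09-02T03:41Z to LA1-p02 (g2)): ★
(J10-iii-a) `finrank_HmkQ_baseChangeComplex_eq_of_isPullback` — «the cohomology counts of the Grothendieck complex after an affine base change are the Čech counts
of the pulled-back bundle» — INSTANTIATED on the SLICE SQUARE at a `K`-point `y : Spec K → T` of the affine test base (★ B4 §4 `isPullback_lift_id_toSpecOver_left`:
`s = (𝟙, y) : P → P ×_K T` is cartesian over `y`), for the Grothendieck complex `K•` of ★ `GrothendieckComplexKernelRepr` (`grothendieckComplex P T 𝓥 L hV hcov hL`,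
its quasi-isomorphism `grothendieckMap` to `Č•(𝓥, L)`, finite projective terms in degrees `[0, #ι]`: `grothendieckComplex_spec`).  HC_CM is proved only modulo the
7 printed citations until rung 0 closes; nothing here bears on a summit statement (count-neutral capital).

THE MATHEMATICS.  `P → Spec K` proper, geometrically integral, flat, universally open; `T` an affine noetherian `K`-scheme; `𝓥` a finite cover of `P ×_K T` with affine
non-empty finite intersections; `L` a line bundle on `P ×_K T`; `K• → Č•(𝓥, L)` the Grothendieck complex over `A = Γ(T, 𝒪)` (flat — indeed projective — terms,
bounded by `#ι`).  For a `K`-point `y` of `T`, the slice `s = (𝟙_P, y) : P → P ×_K T` presents `P` as the fibre `(P ×_K T) ×_T y` ([StacksProject] 01JO), the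
projection `P ×_K T → T` is flat (base change of `P → Spec K`), so [MumfordAV1970] §5 Cor. 2 (★ (J10-iii-a)) reads: for all degrees `a + 1 = b + 0 = b`, `b + 1 = c`,
`finrank_{Γ(y)} H^b_mkQ(K• ⊗_A Γ(y)) = finrank_{Γ(y)} H^b_mkQ(Č•((s⁻¹V_i)_i, s^*L; Γ(P → Spec K)))`, `Γ(y) = Γ(Spec K, 𝒪)` an `A`-algebra through `y♯`
(`(y.toSpecHom.appLE ⊤ ⊤ _).hom.toAlgebra`, the ★ (J10-iii-a) convention).

* `flat_snd_left` — `P ×_K T → T` is flat; `flat_grothendieckComplex_X` — the terms of `K•` are flat (projective);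
* **`nonempty_HmkQ_baseChangeComplex_grothendieckComplex_linearEquiv_slice`** (the `Γ(y)`-linear isomorphism, any degrees `a+1=b`, `b+1=c`),
  **`finrank_HmkQ_baseChangeComplex_grothendieckComplex_eq_slice`** (equal `finrank`), and the degree-one reading
  **`finrank_HOne_baseChangeComplex_grothendieckComplex_eq_slice`** (`a b c := 0 1 2`) — the shape B-p04՚s HEAD consumes before ★ FILE 1b turns the right-hand side into
  `finrank K (CechH1 P.hom (fun i => s ⁻¹ᵁ 𝓥 i))` along an iso `s^*L ≅ 𝒪_P`.

## References
* [MumfordAV1970] D. Mumford, *Abelian Varieties* (1970), §5 Lemma 2 (p. 49) and Cor. 2 (pp. 50–51).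
* [GortzWedhorn2023] U. Görtz, T. Wedhorn, *Algebraic Geometry II* (2023), Prop. 22.90 (p. 277), Cor. 23.135 (p. 355).
* [StacksProject] The Stacks Project, Tag 01JO (fibre products and points), Tag 02KH (base change of flat morphisms).
-/

set_option autoImplicit false
set_option backward.isDefEq.respectTransparency false -- `(P ⊗ T).left`, `snd`, `baseToTotal` are semireducible wrappers (as in ★ `GrothendieckComplexKernelRepr`)

noncomputable section

open CategoryTheory CategoryTheory.Limits AlgebraicGeometry TopologicalSpace Opposite MonoidalCategory CartesianMonoidalCategory
open Literature.AlgebraicGeometry.Motives Literature.Algebra.Homology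

namespace Literature.AlgebraicGeometry.Modules

variable {K : Type} [Field K] (P T : SchemeOver K) [IsAffine T.left]
  [IsProper P.hom] [GeometricallyIntegral P.hom] [Flat P.hom] [UniversallyOpen P.hom]
  [IsNoetherianRing Γ(T.left, ⊤)] [IsLocallyNoetherian T.left]
  {ι : Type} [LinearOrder ι] [Fintype ι] (𝓥 : ι → (P ⊗ T).left.Opens) (L : (P ⊗ T).left.Modules)
  (hV : ∀ s : Finset ι, s.Nonempty → IsAffineOpen (cechOpen 𝓥 s)) (hcov : ⨆ i, 𝓥 i = ⊤) (hL : HasRank L 1)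

omit [IsAffine T.left] [IsProper P.hom] [GeometricallyIntegral P.hom] [UniversallyOpen P.hom] [IsNoetherianRing Γ(T.left, ⊤)] [IsLocallyNoetherian T.left] in
/-- The projection `P ×_K T → T` is flat (base change of the flat `P → Spec K`; Mathlib `pullback.snd` instance, ★ `snd_left_eq`). [cite: StacksProject, Tag 02KH] -/
theorem flat_snd_left : Flat (snd P T).left :=
  inferInstanceAs (Flat (pullback.snd P.hom T.hom))

/-- The terms of the Grothendieck complex are flat `Γ(T)`-modules (they are projective, ★ `grothendieckComplex_spec`; Mathlib `Module.Flat.of_projective`).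
[cite: MumfordAV1970, §5 Lemma 1 (p. 47)] [cite: GortzWedhorn2023, Cor. 23.135 (p. 355)] -/
theorem flat_grothendieckComplex_X (n : ℤ) : Module.Flat Γ(T.left, ⊤) ((grothendieckComplex P T 𝓥 L hV hcov hL).X n) := by
  haveI := ((grothendieckComplex_spec P T 𝓥 L hV hcov hL).2.2.2 n).2
  exact Module.Flat.of_projective

/-- **THE SLICE READING, linear-isomorphism form**: at a `K`-point `y` of `T`, with `s = (𝟙, y) : P → P ×_K T`, for degrees `a + 1 = b`, `b + 1 = c`,
`H^b_mkQ(K• ⊗_{Γ(T)} Γ(Spec K)) ≃ₗ H^b_mkQ(Č•((s⁻¹V_i)_i, s^*L; Γ(P → Spec K)))` over `Γ(Spec K, 𝒪)` (an algebra over `Γ(T)` through `y♯`) — ★ (J10-iii-a)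
`nonempty_HmkQ_baseChangeComplex_linearEquiv_of_isPullback` on the slice square ★ `isPullback_lift_id_toSpecOver_left` (`g := (snd P T).left` flat, `ψ := grothendieckMap`,
flat terms, bound `#ι` from ★ `grothendieckComplex_spec`, `L` finite locally free from `HasRank L 1`).
[cite: MumfordAV1970, §5 Lemma 2 (p. 49) and Cor. 2 (pp. 50–51)] [cite: StacksProject, Tag 01JO] -/
theorem nonempty_HmkQ_baseChangeComplex_grothendieckComplex_linearEquiv_slice (y : AlgPoints T K) (a b c : ℤ) (hab : a + 1 = b) (hbc : b + 1 = c) :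
    letI := (y.toSpecHom.appLE ⊤ ⊤ le_top).hom.toAlgebra
    Nonempty (↥((LinearMap.ker ((baseChangeComplex Γ(Spec (.of K), ⊤) (grothendieckComplex P T 𝓥 L hV hcov hL)).d b c).hom).map
        (LinearMap.range ((baseChangeComplex Γ(Spec (.of K), ⊤) (grothendieckComplex P T 𝓥 L hV hcov hL)).d a b).hom).mkQ) ≃ₗ[Γ(Spec (.of K), ⊤)]
      ↥((LinearMap.ker ((cechComplex (fun i => (lift (𝟙 P) (toSpecOver P ≫ y)).left ⁻¹ᵁ 𝓥 i)
          ((Scheme.Modules.pullback (lift (𝟙 P) (toSpecOver P ≫ y)).left).obj L) P.hom.appTop.hom).d b c).hom).map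
        (LinearMap.range ((cechComplex (fun i => (lift (𝟙 P) (toSpecOver P ≫ y)).left ⁻¹ᵁ 𝓥 i)
          ((Scheme.Modules.pullback (lift (𝟙 P) (toSpecOver P ≫ y)).left).obj L) P.hom.appTop.hom).d a b).hom).mkQ)) := by
  obtain ⟨hq, -, hle, -⟩ := grothendieckComplex_spec P T 𝓥 L hV hcov hL
  haveI := hq
  haveI := hle
  haveI := flat_snd_left P T
  exact nonempty_HmkQ_baseChangeComplex_linearEquiv_of_isPullback (isPullback_lift_id_toSpecOver_left P T y) 𝓥 hV (HasRank.isFiniteLocallyFree' hL)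
    (grothendieckMap P T 𝓥 L hV hcov hL) (flat_grothendieckComplex_X P T 𝓥 L hV hcov hL) (Fintype.card ι : ℤ) (by omega) a b c hab hbc

/-- **THE SLICE READING OF THE GROTHENDIECK COMPLEX** ([MumfordAV1970] §5 Cor. 2 at a rational point): for degrees `a + 1 = b`, `b + 1 = c`,
`finrank_{Γ(Spec K)} H^b_mkQ(K• ⊗_{Γ(T)} Γ(Spec K)) = finrank_{Γ(Spec K)} H^b_mkQ(Č•((s⁻¹V_i)_i, s^*L; Γ(P → Spec K)))`, `s = (𝟙, y)`, the algebra structure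
`Γ(T) → Γ(Spec K)` being `y♯` (★ (J10-iii-a) `finrank_HmkQ_baseChangeComplex_eq_of_isPullback` on the slice square). [cite: MumfordAV1970, §5 Cor. 2 (pp. 50–51)]
[cite: GortzWedhorn2023, Cor. 23.135 (p. 355)] [cite: StacksProject, Tag 01JO] -/
theorem finrank_HmkQ_baseChangeComplex_grothendieckComplex_eq_slice (y : AlgPoints T K) (a b c : ℤ) (hab : a + 1 = b) (hbc : b + 1 = c) :
    letI := (y.toSpecHom.appLE ⊤ ⊤ le_top).hom.toAlgebra
    Module.finrank Γ(Spec (.of K), ⊤) ↥((LinearMap.ker ((baseChangeComplex Γ(Spec (.of K), ⊤) (grothendieckComplex P T 𝓥 L hV hcov hL)).d b c).hom).map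
        (LinearMap.range ((baseChangeComplex Γ(Spec (.of K), ⊤) (grothendieckComplex P T 𝓥 L hV hcov hL)).d a b).hom).mkQ) =
      Module.finrank Γ(Spec (.of K), ⊤) ↥((LinearMap.ker ((cechComplex (fun i => (lift (𝟙 P) (toSpecOver P ≫ y)).left ⁻¹ᵁ 𝓥 i)
          ((Scheme.Modules.pullback (lift (𝟙 P) (toSpecOver P ≫ y)).left).obj L) P.hom.appTop.hom).d b c).hom).map
        (LinearMap.range ((cechComplex (fun i => (lift (𝟙 P) (toSpecOver P ≫ y)).left ⁻¹ᵁ 𝓥 i)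
          ((Scheme.Modules.pullback (lift (𝟙 P) (toSpecOver P ≫ y)).left).obj L) P.hom.appTop.hom).d a b).hom).mkQ) := by
  obtain ⟨hq, -, hle, -⟩ := grothendieckComplex_spec P T 𝓥 L hV hcov hL
  haveI := hq
  haveI := hle
  haveI := flat_snd_left P T
  exact finrank_HmkQ_baseChangeComplex_eq_of_isPullback (isPullback_lift_id_toSpecOver_left P T y) 𝓥 hV (HasRank.isFiniteLocallyFree' hL)
    (grothendieckMap P T 𝓥 L hV hcov hL) (flat_grothendieckComplex_X P T 𝓥 L hV hcov hL) (Fintype.card ι : ℤ) (by omega) a b c hab hbc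

/-- **DEGREE ONE — the shape the H1-DIM HEAD eats**: `finrank_{Γ(Spec K)} H¹_mkQ(K• ⊗_{Γ(T)} Γ(Spec K)) = finrank_{Γ(Spec K)} H¹_mkQ(Č•((s⁻¹V_i)_i, s^*L; Γ(P → Spec K)))`
(`a b c := 0 1 2`). [cite: MumfordAV1970, §5 Cor. 2 (pp. 50–51)] [cite: GortzWedhorn2023, Cor. 23.135 (p. 355)] -/
theorem finrank_HOne_baseChangeComplex_grothendieckComplex_eq_slice (y : AlgPoints T K) :
    letI := (y.toSpecHom.appLE ⊤ ⊤ le_top).hom.toAlgebra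
    Module.finrank Γ(Spec (.of K), ⊤) ↥((LinearMap.ker ((baseChangeComplex Γ(Spec (.of K), ⊤) (grothendieckComplex P T 𝓥 L hV hcov hL)).d 1 2).hom).map
        (LinearMap.range ((baseChangeComplex Γ(Spec (.of K), ⊤) (grothendieckComplex P T 𝓥 L hV hcov hL)).d 0 1).hom).mkQ) =
      Module.finrank Γ(Spec (.of K), ⊤) ↥((LinearMap.ker ((cechComplex (fun i => (lift (𝟙 P) (toSpecOver P ≫ y)).left ⁻¹ᵁ 𝓥 i)
          ((Scheme.Modules.pullback (lift (𝟙 P) (toSpecOver P ≫ y)).left).obj L) P.hom.appTop.hom).d 1 2).hom).map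
        (LinearMap.range ((cechComplex (fun i => (lift (𝟙 P) (toSpecOver P ≫ y)).left ⁻¹ᵁ 𝓥 i)
          ((Scheme.Modules.pullback (lift (𝟙 P) (toSpecOver P ≫ y)).left).obj L) P.hom.appTop.hom).d 0 1).hom).mkQ) :=
  finrank_HmkQ_baseChangeComplex_grothendieckComplex_eq_slice P T 𝓥 L hV hcov hL y 0 1 2 (by norm_num) (by norm_num)

end Literature.AlgebraicGeometry.Modules

end
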